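import Literature.Analysis.DeBrangesSpaces.BurnolSonineSpaces
import Literature.Analysis.SpecialFunctions.MellinSin
import Literature.Analysis.Complex.HolomorphicParametricIntegral
import Mathlib.MeasureTheory.Integral.IntegralEqImproper
import Mathlib.Analysis.SpecialFunctions.ImproperIntegrals
import Mathlib.Analysis.SpecialFunctions.Integrability.Basic
import Mathlib.Analysis.SpecialFunctions.Gamma.Deriv
import Mathlib.Analysis.Complex.Convex
import HarnessLib

/-!
# Burnol 2001 (CRAS 333), Lemme 1.3: the closed form of the cosine kernel `C_a(u, w)` — proofs

LABEL (line 1): **RH-FREE** — classical analysis (Mellin transforms of `cos` / `sin`, one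
integration by parts, analytic continuation); `ζ` does not occur. bears_on: LADDER-RH COLUMN 6 (DBR),
B-C/B-P, as corpus vocabulary only. WHAT THIS IS NOT: not a route, not a criterion; discharging a
closed-form lemma of Burnol's Note fixes the vocabulary of a corpus, it does not move RH; nothing here
bears on the truth of RH.

This is a PROOF-ONLY companion of `BurnolSonineSpaces.lean` (J.-F. Burnol, *Sur certains espaces de
Hilbert de fonctions entières …*, C. R. Acad. Sci. Paris Sér. I **333** (2001) 201–206 =
arXiv:math/0105120 [Burnol2001CRAS]; TeX of record `dbl/src/Burnol2001CRAS_arXivmath0105120.tex`).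
It DISCHARGES the named fact `Burnol2001CRAS_lem1_3` (the closed-form clauses of Lemme 1.3, TeX
l.352–367): for `a, u > 0` and THE entire continuation `G` of
`w ↦ C_a(u, w) = 2∫_a^∞ cos(2πut) t^{w−1} dt` (`Re w < 0`; `IsBurnolC a u G`),

* (i) `G(w) = γ₊(w) u^{−w} − 2∫₀^a cos(2πut) t^{w−1} dt` for `Re w > 0` (eq. (1.3));
* (ii) `G(1 + 2j) = −2∫₀^a cos(2πut) t^{2j} dt` (`j ∈ ℕ`), i.e. `C_a(u,1+2j) = −𝓕₊(𝟙_{t≤a}t^{2j})(u)`.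

## The argument (and where it deviates from print)

Burnol obtains (1.3) from Fubini against test functions and the Mellin–Plancherel relation (1.1)
`f̂(s) = γ₊(s) (𝓕₊f)^(1−s)` (TeX l.346–352). The tree already holds the absolutely convergent Mellin
transform of the sine, `Literature.Analysis.SpecialFunctions.mellin_sin`
(`∫₀^∞ sin(x) x^{z−1} dx = Γ(z) sin(πz/2)`, `−1 < Re z < 0`), so we take the shorter road through
Burnol's own integration by parts (TeX l.333–336):

1. (`burnolC_eq_ibp`) for `Re w < 0`,
   `C_a(u,w) = −(sin(2πau)/(πu)) a^{w−1} − ((w−1)/(πu)) ∫_a^∞ sin(2πut) t^{w−2} dt` — the printed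
   identity; its right-hand side `H(w)` is holomorphic on `Re w < 1` (dominated holomorphic parametric
   integral, `Literature.Analysis.Complex.differentiableOn_integral_of_dominated`), so `G = H` on
   `Re w < 1` by the identity theorem (`IsBurnolC.eq_ibp`).
2. On the strip `0 < Re w < 1` (`ibp_eq_closedForm`): split `∫_a^∞ = ∫₀^∞ − ∫₀^a`; the first piece is
   `(2πu)^{1−w} Γ(w−1) sin(π(w−1)/2)` (`mellin_sin` rescaled, `integral_sin_mul_cpow_Ioi_zero`); the
   pieces over `(0, a]` recombine into `2∫₀^a cos(2πut) t^{w−1} dt` by the integration by parts on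
   `(0, a]` (`two_mul_integral_cos_mul_cpow_Ioc`, boundary term at `0⁺` vanishes since `Re w > 0`); and
   `−((w−1)/(πu)) (2πu)^{1−w} Γ(w−1) sin(π(w−1)/2) = 2(2πu)^{−w} cos(πw/2) Γ(w) = γ₊(w) u^{−w}`
   (`Γ(w) = (w−1)Γ(w−1)`, `sin(x − π/2) = −cos x`).
3. Both sides of (i) are holomorphic on `Re w > 0` and agree on the strip, hence on `Re w > 0`
   (identity theorem). (ii) is (i) at `w = 1 + 2j`, where `cos(π(1+2j)/2) = 0` kills `γ₊`.

No definitions, no new named facts (D-0026): the file only proves theorems about the objects of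
`BurnolSonineSpaces.lean`. It does not construct the continuation `G` (that is Lemme 1.2,
`Burnol2001CRAS_lem1_2`, a separate fact); every statement here quantifies over a given `G` with
`IsBurnolC a u G`.

## References
* [Burnol2001CRAS] J.-F. Burnol, C. R. Acad. Sci. Paris Sér. I 333 (2001) 201–206 = arXiv:math/0105120,
  Lemme 1.3 and eq. (1.3) (TeX l.333–367).
* Euler's integrals `∫₀^∞ x^{z−1} sin x dx = Γ(z) sin(πz/2)`, `∫₀^∞ x^{z−1} cos x dx = Γ(z) cos(πz/2)`:
  E. C. Titchmarsh, *The Theory of the Riemann Zeta-Function*, §2.1 (tree file `MellinSin.lean`).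
-/

noncomputable section

open _root_.MeasureTheory _root_.Complex _root_.Set _root_.Filter _root_.Metric
open scoped Real Topology

namespace Literature.Analysis.DeBrangesSpaces

namespace Burnol2001

/-! ## Pointwise tools: `t ↦ (t : ℂ) ^ s` on `t > 0`, and the trigonometric factors -/

/-- `d/dt (t : ℂ)^s = s (t : ℂ)^{s−1}` for real `t > 0`. [folklore] -/
private theorem hasDerivAt_ofReal_cpow {t : ℝ} (ht : 0 < t) (s : ℂ) :
    HasDerivAt (fun y : ℝ ↦ (y : ℂ) ^ s) (s * (t : ℂ) ^ (s - 1)) t :=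
  (Complex.hasStrictDerivAt_cpow_const (c := s)
    (Complex.ofReal_mem_slitPlane.2 ht)).hasDerivAt.comp_ofReal

/-- Continuity of `t ↦ (t : ℂ)^s` on `(0, ∞)`. [folklore] -/
private theorem continuousOn_ofReal_cpow (s : ℂ) :
    ContinuousOn (fun y : ℝ ↦ (y : ℂ) ^ s) (Ioi 0) := fun _ ht ↦
  (hasDerivAt_ofReal_cpow ht s).continuousAt.continuousWithinAt

/-- `‖(t : ℂ)^s‖ = t^{Re s}` for `t > 0`. [folklore] -/
private theorem norm_ofReal_cpow {t : ℝ} (ht : 0 < t) (s : ℂ) : ‖(t : ℂ) ^ s‖ = t ^ s.re :=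
  Complex.norm_cpow_eq_rpow_re_of_pos ht s

/-- `‖(cos x : ℂ)‖ ≤ 1`. [folklore] -/
private theorem norm_ofReal_cos_le (x : ℝ) : ‖((Real.cos x : ℝ) : ℂ)‖ ≤ 1 := by
  rw [Complex.norm_real, Real.norm_eq_abs]; exact Real.abs_cos_le_one x

/-- `‖(sin x : ℂ)‖ ≤ 1`. [folklore] -/
private theorem norm_ofReal_sin_le (x : ℝ) : ‖((Real.sin x : ℝ) : ℂ)‖ ≤ 1 := by
  rw [Complex.norm_real, Real.norm_eq_abs]; exact Real.abs_sin_le_one x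

/-- `‖(sin x : ℂ)‖ ≤ |x|`. [folklore] -/
private theorem norm_ofReal_sin_le_abs (x : ℝ) : ‖((Real.sin x : ℝ) : ℂ)‖ ≤ |x| := by
  rw [Complex.norm_real, Real.norm_eq_abs]; exact Real.abs_sin_le_abs

/-- Continuity of `t ↦ cos(2πut)` as a complex-valued function. [folklore] -/
private theorem continuous_cosC (u : ℝ) : Continuous fun t : ℝ ↦ ((Real.cos (2 * π * u * t) : ℝ) : ℂ) :=
  Complex.continuous_ofReal.comp (Real.continuous_cos.comp (continuous_const.mul continuous_id))

/-- Continuity of `t ↦ sin(2πut)` as a complex-valued function. [folklore] -/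
private theorem continuous_sinC (u : ℝ) : Continuous fun t : ℝ ↦ ((Real.sin (2 * π * u * t) : ℝ) : ℂ) :=
  Complex.continuous_ofReal.comp (Real.continuous_sin.comp (continuous_const.mul continuous_id))

/-- The primitive `V(t) = sin(2πut)/(2πu)` of `cos(2πut)` (`u ≠ 0`), complex-valued:
`V'(t) = cos(2πut)`. [folklore] -/
private theorem hasDerivAt_sin_div {u : ℝ} (hu : u ≠ 0) (t : ℝ) :
    HasDerivAt (fun y : ℝ ↦ ((Real.sin (2 * π * u * y) : ℝ) : ℂ) / (2 * π * u))
      ((Real.cos (2 * π * u * t) : ℝ) : ℂ) t := by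
  have h1 : HasDerivAt (fun y : ℝ ↦ Real.sin (2 * π * u * y))
      (Real.cos (2 * π * u * t) * (2 * π * u * 1)) t :=
    ((hasDerivAt_id t).const_mul (2 * π * u)).sin
  have h2 := (h1.ofReal_comp).div_const ((2 : ℂ) * π * u)
  refine h2.congr_deriv ?_
  have hπ : (π : ℂ) ≠ 0 := by exact_mod_cast Real.pi_ne_zero
  have hu' : (u : ℂ) ≠ 0 := by exact_mod_cast hu
  push_cast
  field_simp

/-! ## Integrability of the kernels -/

/-- `cos(2πut) t^s` is integrable on `(c, ∞)` (`c > 0`) when `Re s < −1`. [folklore] -/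
private theorem integrableOn_cos_mul_cpow_Ioi {c : ℝ} (hc : 0 < c) (u : ℝ) {s : ℂ}
    (hs : s.re < -1) :
    IntegrableOn (fun t : ℝ ↦ ((Real.cos (2 * π * u * t) : ℝ) : ℂ) * (t : ℂ) ^ s) (Ioi c) := by
  refine Integrable.mono' ((integrableOn_Ioi_cpow_of_lt hs hc).norm) ?_ ?_
  · exact ((continuous_cosC u).continuousOn.mul
      ((continuousOn_ofReal_cpow s).mono (Ioi_subset_Ioi hc.le))).aestronglyMeasurable
      measurableSet_Ioi
  · filter_upwards [ae_restrict_mem measurableSet_Ioi] with t _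
    rw [norm_mul]
    exact mul_le_of_le_one_left (norm_nonneg _) (norm_ofReal_cos_le _)

/-- `sin(2πut) t^s` is integrable on `(c, ∞)` (`c > 0`) when `Re s < −1`. [folklore] -/
private theorem integrableOn_sin_mul_cpow_Ioi {c : ℝ} (hc : 0 < c) (u : ℝ) {s : ℂ}
    (hs : s.re < -1) :
    IntegrableOn (fun t : ℝ ↦ ((Real.sin (2 * π * u * t) : ℝ) : ℂ) * (t : ℂ) ^ s) (Ioi c) := by
  refine Integrable.mono' ((integrableOn_Ioi_cpow_of_lt hs hc).norm) ?_ ?_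
  · exact ((continuous_sinC u).continuousOn.mul
      ((continuousOn_ofReal_cpow s).mono (Ioi_subset_Ioi hc.le))).aestronglyMeasurable
      measurableSet_Ioi
  · filter_upwards [ae_restrict_mem measurableSet_Ioi] with t _
    rw [norm_mul]
    exact mul_le_of_le_one_left (norm_nonneg _) (norm_ofReal_sin_le _)

/-- `cos(2πut) t^s` is integrable on `(0, a]` when `Re s > −1`. [folklore] -/
private theorem integrableOn_cos_mul_cpow_Ioc {a : ℝ} (ha : 0 < a) (u : ℝ) {s : ℂ}
    (hs : -1 < s.re) :
    IntegrableOn (fun t : ℝ ↦ ((Real.cos (2 * π * u * t) : ℝ) : ℂ) * (t : ℂ) ^ s) (Ioc 0 a) := by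
  have hpow : IntegrableOn (fun t : ℝ ↦ (t : ℂ) ^ s) (Ioc 0 a) := by
    rw [integrableOn_Ioc_iff_integrableOn_Ioo]
    exact (intervalIntegral.integrableOn_Ioo_cpow_iff ha).2 hs
  refine Integrable.mono' hpow.norm ?_ ?_
  · exact ((continuous_cosC u).continuousOn.mul
      ((continuousOn_ofReal_cpow s).mono Ioc_subset_Ioi_self)).aestronglyMeasurable
      measurableSet_Ioc
  · filter_upwards [ae_restrict_mem measurableSet_Ioc] with t _
    rw [norm_mul]
    exact mul_le_of_le_one_left (norm_nonneg _) (norm_ofReal_cos_le _)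

/-- `sin(2πut) t^{w−2}` is integrable on `(0, a]` when `Re w > 0` (`u > 0`): the sine supplies one
power of `t`, `|sin(2πut) t^{w−2}| ≤ 2πu · t^{Re w − 1}`. [folklore] -/
private theorem integrableOn_sin_mul_cpow_Ioc {a u : ℝ} (ha : 0 < a) (hu : 0 < u) {w : ℂ}
    (hw : 0 < w.re) :
    IntegrableOn (fun t : ℝ ↦ ((Real.sin (2 * π * u * t) : ℝ) : ℂ) * (t : ℂ) ^ (w - 2)) (Ioc 0 a) := by
  have hrpow : IntegrableOn (fun t : ℝ ↦ 2 * π * u * t ^ (w.re - 1)) (Ioc 0 a) := by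
    have h := (intervalIntegral.intervalIntegrable_rpow' (a := 0) (b := a)
      (by linarith : -1 < w.re - 1))
    exact ((intervalIntegrable_iff_integrableOn_Ioc_of_le ha.le).1 h).const_mul _
  refine Integrable.mono' hrpow ?_ ?_
  · exact ((continuous_sinC u).continuousOn.mul
      ((continuousOn_ofReal_cpow (w - 2)).mono Ioc_subset_Ioi_self)).aestronglyMeasurable
      measurableSet_Ioc
  · filter_upwards [ae_restrict_mem measurableSet_Ioc] with t ht
    have ht0 : 0 < t := ht.1
    rw [norm_mul, norm_ofReal_cpow ht0, Complex.sub_re, show (2 : ℂ).re = 2 by norm_num]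
    have h1 : ‖((Real.sin (2 * π * u * t) : ℝ) : ℂ)‖ ≤ 2 * π * u * t := by
      refine (norm_ofReal_sin_le_abs _).trans (le_of_eq (abs_of_pos (by positivity)))
    calc ‖((Real.sin (2 * π * u * t) : ℝ) : ℂ)‖ * t ^ (w.re - 2)
        ≤ (2 * π * u * t) * t ^ (w.re - 2) :=
          mul_le_mul_of_nonneg_right h1 (Real.rpow_nonneg ht0.le _)
      _ = 2 * π * u * t ^ (w.re - 1) := by
          rw [show w.re - 1 = 1 + (w.re - 2) by ring, Real.rpow_add ht0, Real.rpow_one]; ring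

/-! ## Limits of the boundary term `t^{w−1} sin(2πut)/(2πu)` -/

/-- At `+∞`: `t^{w−1} sin(2πut)/(2πu) → 0` when `Re w < 1`. [folklore] -/
private theorem tendsto_boundary_atTop {u : ℝ} (hu : 0 < u) {w : ℂ} (hw : w.re < 1) :
    Tendsto (fun t : ℝ ↦ (t : ℂ) ^ (w - 1) *
      (((Real.sin (2 * π * u * t) : ℝ) : ℂ) / (2 * π * u))) atTop (𝓝 0) := by
  have hc : 0 < 2 * π * u := by positivity
  refine squeeze_zero_norm' (a := fun t : ℝ ↦ t ^ (-(1 - w.re)) * (2 * π * u)⁻¹) ?_ ?_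
  · filter_upwards [eventually_gt_atTop (0 : ℝ)] with t ht
    rw [norm_mul, norm_ofReal_cpow ht, norm_div, Complex.sub_re, Complex.one_re,
      show -(1 - w.re) = w.re - 1 by ring]
    refine mul_le_mul_of_nonneg_left ?_ (Real.rpow_nonneg ht.le _)
    have hn : ‖((2 : ℂ) * π * u)‖ = 2 * π * u := by
      rw [show ((2 : ℂ) * π * u) = ((2 * π * u : ℝ) : ℂ) by push_cast; ring, Complex.norm_real,
        Real.norm_of_nonneg hc.le]
    rw [hn, div_eq_mul_inv]
    exact mul_le_of_le_one_left (inv_nonneg.2 hc.le) (norm_ofReal_sin_le _)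
  · have h := (tendsto_rpow_neg_atTop (by linarith : 0 < 1 - w.re)).mul_const (2 * π * u)⁻¹
    rwa [zero_mul] at h

/-- At `0⁺`: `t^{w−1} sin(2πut)/(2πu) → 0` when `Re w > 0` (`|sin x| ≤ |x|`). [folklore] -/
private theorem tendsto_boundary_zero {u : ℝ} (hu : 0 < u) {w : ℂ} (hw : 0 < w.re) :
    Tendsto (fun t : ℝ ↦ (t : ℂ) ^ (w - 1) *
      (((Real.sin (2 * π * u * t) : ℝ) : ℂ) / (2 * π * u))) (𝓝[>] 0) (𝓝 0) := by
  have hc : 0 < 2 * π * u := by positivity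
  refine squeeze_zero_norm' (a := fun t : ℝ ↦ t ^ w.re) ?_ ?_
  · filter_upwards [self_mem_nhdsWithin] with t (ht : 0 < t)
    rw [norm_mul, norm_ofReal_cpow ht, norm_div, Complex.sub_re, Complex.one_re]
    have hn : ‖((2 : ℂ) * π * u)‖ = 2 * π * u := by
      rw [show ((2 : ℂ) * π * u) = ((2 * π * u : ℝ) : ℂ) by push_cast; ring, Complex.norm_real,
        Real.norm_of_nonneg hc.le]
    rw [hn]
    have h1 : ‖((Real.sin (2 * π * u * t) : ℝ) : ℂ)‖ / (2 * π * u) ≤ t := by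
      rw [div_le_iff₀ hc]
      refine (norm_ofReal_sin_le_abs _).trans (le_of_eq ?_)
      rw [abs_of_pos (by positivity)]; ring
    calc t ^ (w.re - 1) * (‖((Real.sin (2 * π * u * t) : ℝ) : ℂ)‖ / (2 * π * u))
        ≤ t ^ (w.re - 1) * t := mul_le_mul_of_nonneg_left h1 (Real.rpow_nonneg ht.le _)
      _ = t ^ w.re := by
          rw [show w.re = (w.re - 1) + 1 by ring, Real.rpow_add ht, Real.rpow_one]; ring_nf
  · have hcont : ContinuousAt (fun t : ℝ ↦ t ^ w.re) 0 :=
      Real.continuousAt_rpow_const 0 w.re (Or.inr hw.le)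
    have := hcont.tendsto
    rw [Real.zero_rpow hw.ne'] at this
    exact this.mono_left nhdsWithin_le_nhds

/-- Continuity of the boundary term at a point `t₀ > 0`. [folklore] -/
private theorem continuousAt_boundary {u : ℝ} (hu : 0 < u) (w : ℂ) {t₀ : ℝ} (ht₀ : 0 < t₀) :
    ContinuousAt (fun t : ℝ ↦ (t : ℂ) ^ (w - 1) *
      (((Real.sin (2 * π * u * t) : ℝ) : ℂ) / (2 * π * u))) t₀ :=
  (hasDerivAt_ofReal_cpow ht₀ (w - 1)).continuousAt.mul
    (hasDerivAt_sin_div hu.ne' t₀).continuousAt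

/-! ## Step 1: the printed integration by parts on `(a, ∞)` and the continuation to `Re w < 1` -/

/-- **Burnol's integration by parts** (TeX l.333–336): for `a, u > 0` and `Re w < 0`,
`C_a(u, w) = 2∫_a^∞ cos(2πut) t^{w−1} dt = −(sin(2πau)/(πu)) a^{w−1} − ((w−1)/(πu)) ∫_a^∞ sin(2πut) t^{w−2} dt`.
[cite: Burnol2001CRAS, §1 eq. before Lemme 1.2 (TeX l.333–336)] -/
theorem burnolC_eq_ibp {a u : ℝ} (ha : 0 < a) (hu : 0 < u) {w : ℂ} (hw : w.re < 0) :
    burnolC a u w =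
      -(((Real.sin (2 * π * u * a) : ℝ) : ℂ) / (π * u)) * (a : ℂ) ^ (w - 1)
        - (w - 1) / (π * u) *
          ∫ t in Ioi a, ((Real.sin (2 * π * u * t) : ℝ) : ℂ) * (t : ℂ) ^ (w - 2) := by
  have hπ : (π : ℂ) ≠ 0 := by exact_mod_cast Real.pi_ne_zero
  have hu' : (u : ℂ) ≠ 0 := by exact_mod_cast hu.ne'
  have hc : ((2 : ℂ) * π * u) ≠ 0 := mul_ne_zero (mul_ne_zero two_ne_zero hπ) hu'
  -- the data of the integration by parts
  set U : ℝ → ℂ := fun t ↦ (t : ℂ) ^ (w - 1) with hU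
  set U' : ℝ → ℂ := fun t ↦ (w - 1) * (t : ℂ) ^ (w - 2) with hU'
  set V : ℝ → ℂ := fun t ↦ ((Real.sin (2 * π * u * t) : ℝ) : ℂ) / (2 * π * u) with hV
  set V' : ℝ → ℂ := fun t ↦ ((Real.cos (2 * π * u * t) : ℝ) : ℂ) with hV'
  have hUd : ∀ t ∈ Ioi a, HasDerivAt U (U' t) t := by
    intro t ht
    have ht0 : 0 < t := ha.trans ht
    have h := hasDerivAt_ofReal_cpow ht0 (w - 1)
    rw [hU, hU']
    convert h using 2
    ring_nf
  have hVd : ∀ t ∈ Ioi a, HasDerivAt V (V' t) t := fun t _ ↦ hasDerivAt_sin_div hu.ne' t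
  have hUV' : IntegrableOn (U * V') (Ioi a) := by
    have h := integrableOn_cos_mul_cpow_Ioi ha u (s := w - 1)
      (by rw [Complex.sub_re, Complex.one_re]; linarith)
    refine h.congr_fun (fun t _ ↦ ?_) measurableSet_Ioi
    simp only [hU, hV', Pi.mul_apply, mul_comm]
  have hU'V : IntegrableOn (U' * V) (Ioi a) := by
    have h : IntegrableOn (fun t : ℝ ↦ (w - 1) / (2 * π * u) *
        (((Real.sin (2 * π * u * t) : ℝ) : ℂ) * (t : ℂ) ^ (w - 2))) (Ioi a) :=
      (integrableOn_sin_mul_cpow_Ioi ha u (s := w - 2)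
        (by rw [Complex.sub_re]; norm_num; linarith)).const_mul ((w - 1) / (2 * π * u))
    refine h.congr_fun (fun t _ ↦ ?_) measurableSet_Ioi
    simp only [hU', hV, Pi.mul_apply]
    field_simp
  have h0 : Tendsto (U * V) (𝓝[>] a) (𝓝 (U a * V a)) := by
    have h := (continuousAt_boundary hu w ha).tendsto
    exact h.mono_left nhdsWithin_le_nhds
  have hinf : Tendsto (U * V) atTop (𝓝 0) := tendsto_boundary_atTop hu (by linarith)
  have hibp := integral_Ioi_mul_deriv_eq_deriv_mul hUd hVd hUV' hU'V h0 hinf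
  -- rewrite `C_a(u,w)` through it
  have hC : burnolC a u w = 2 * ∫ t in Ioi a, U t * V' t := by
    rw [burnolC]
    congr 1
    refine setIntegral_congr_fun measurableSet_Ioi (fun t _ ↦ ?_)
    simp only [hU, hV', mul_comm]
  have hI : ∫ t in Ioi a, U' t * V t =
      (w - 1) / (2 * π * u) *
        ∫ t in Ioi a, ((Real.sin (2 * π * u * t) : ℝ) : ℂ) * (t : ℂ) ^ (w - 2) := by
    rw [← integral_const_mul]
    refine setIntegral_congr_fun measurableSet_Ioi (fun t _ ↦ ?_)
    simp only [hU', hV]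
    field_simp
  rw [hC, hibp, hI, zero_sub]
  simp only [hU, hV]
  field_simp

/-- The right-hand side of `burnolC_eq_ibp` is holomorphic on `Re w < 1`: the parametric integral
`w ↦ ∫_a^∞ sin(2πut) t^{w−2} dt` is dominated, locally uniformly in `w`, by integrable powers of `t`.
[folklore] -/
private theorem differentiableOn_integral_sin_mul_cpow_Ioi {a : ℝ} (ha : 0 < a) (u : ℝ) :
    DifferentiableOn ℂ
      (fun w : ℂ ↦ ∫ t in Ioi a, ((Real.sin (2 * π * u * t) : ℝ) : ℂ) * (t : ℂ) ^ (w - 2))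
      {w : ℂ | w.re < 1} := by
  refine Literature.Analysis.Complex.differentiableOn_integral_of_dominated
    (μ := volume.restrict (Ioi a))
    (F := fun (w : ℂ) (t : ℝ) ↦ ((Real.sin (2 * π * u * t) : ℝ) : ℂ) * (t : ℂ) ^ (w - 2))
    (fun w _ ↦ ?_) ?_ (fun x₀ hx₀ ↦ ?_)
  · exact ((continuous_sinC u).continuousOn.mul
      ((continuousOn_ofReal_cpow (w - 2)).mono (Ioi_subset_Ioi ha.le))).aestronglyMeasurable
      measurableSet_Ioi
  · filter_upwards [ae_restrict_mem measurableSet_Ioi] with t ht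
    have ht0 : (t : ℂ) ≠ 0 := by exact_mod_cast (ha.trans ht).ne'
    exact (Differentiable.differentiableOn fun w ↦
      (((differentiableAt_id.sub_const (2 : ℂ)).const_cpow (Or.inl ht0)).const_mul _))
  · have hx₀' : x₀.re < 1 := hx₀
    set R : ℝ := (1 - x₀.re) / 2 with hR
    have hR0 : 0 < R := by rw [hR]; linarith
    refine ⟨R, hR0, fun p hp ↦ ?_, fun t ↦ t ^ (x₀.re + R - 2) + t ^ (x₀.re - R - 2), ?_, ?_⟩
    · show p.re < 1
      have h1 : |(p - x₀).re| ≤ ‖p - x₀‖ := Complex.abs_re_le_norm _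
      rw [mem_ball, dist_eq_norm] at hp
      rw [Complex.sub_re] at h1
      have := (abs_le.1 h1).2
      linarith
    · exact (integrableOn_Ioi_rpow_of_lt (by linarith) ha).add
        (integrableOn_Ioi_rpow_of_lt (by linarith) ha)
    · filter_upwards [ae_restrict_mem measurableSet_Ioi] with t ht p hp
      have ht0 : 0 < t := ha.trans ht
      have hp' : |p.re - x₀.re| < R := by
        have h1 : |(p - x₀).re| ≤ ‖p - x₀‖ := Complex.abs_re_le_norm _
        rw [mem_ball, dist_eq_norm] at hp
        rw [Complex.sub_re] at h1
        exact lt_of_le_of_lt h1 hp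
      rw [norm_mul, norm_ofReal_cpow ht0, Complex.sub_re, show (2 : ℂ).re = 2 by norm_num]
      have hle : t ^ (p.re - 2) ≤ t ^ (x₀.re + R - 2) + t ^ (x₀.re - R - 2) := by
        rcases le_or_gt 1 t with h1 | h1
        · calc t ^ (p.re - 2) ≤ t ^ (x₀.re + R - 2) :=
              Real.rpow_le_rpow_of_exponent_le h1 (by linarith [(abs_lt.1 hp').2])
            _ ≤ t ^ (x₀.re + R - 2) + t ^ (x₀.re - R - 2) :=
              le_add_of_nonneg_right (Real.rpow_nonneg ht0.le _)
        · calc t ^ (p.re - 2) ≤ t ^ (x₀.re - R - 2) :=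
              Real.rpow_le_rpow_of_exponent_ge ht0 h1.le (by linarith [(abs_lt.1 hp').1])
            _ ≤ t ^ (x₀.re + R - 2) + t ^ (x₀.re - R - 2) :=
              le_add_of_nonneg_left (Real.rpow_nonneg ht0.le _)
      calc ‖((Real.sin (2 * π * u * t) : ℝ) : ℂ)‖ * t ^ (p.re - 2)
          ≤ 1 * t ^ (p.re - 2) :=
            mul_le_mul_of_nonneg_right (norm_ofReal_sin_le _) (Real.rpow_nonneg ht0.le _)
        _ ≤ t ^ (x₀.re + R - 2) + t ^ (x₀.re - R - 2) := by rw [one_mul]; exact hle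

/-- **Analytic continuation of `C_a(u, ·)` to `Re w < 1`.** The entire continuation `G` of
`C_a(u, ·)` agrees on the half-plane `Re w < 1` with the integrated-by-parts expression of
`burnolC_eq_ibp` ("Cette identité … donne le prolongement analytique … au moins au demi-plan
`Re(s) < 1`", TeX l.330–332). [cite: Burnol2001CRAS, §1 (TeX l.330–336)] -/
theorem IsBurnolC.eq_ibp {a u : ℝ} (ha : 0 < a) (hu : 0 < u) {G : ℂ → ℂ} (hG : IsBurnolC a u G)
    {w : ℂ} (hw : w.re < 1) :
    G w = -(((Real.sin (2 * π * u * a) : ℝ) : ℂ) / (π * u)) * (a : ℂ) ^ (w - 1)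
        - (w - 1) / (π * u) *
          ∫ t in Ioi a, ((Real.sin (2 * π * u * t) : ℝ) : ℂ) * (t : ℂ) ^ (w - 2) := by
  set H : ℂ → ℂ := fun w ↦ -(((Real.sin (2 * π * u * a) : ℝ) : ℂ) / (π * u)) * (a : ℂ) ^ (w - 1)
        - (w - 1) / (π * u) *
          ∫ t in Ioi a, ((Real.sin (2 * π * u * t) : ℝ) : ℂ) * (t : ℂ) ^ (w - 2) with hH
  have hUo : IsOpen {w : ℂ | w.re < 1} := isOpen_lt Complex.continuous_re continuous_const
  have hUc : IsPreconnected {w : ℂ | w.re < 1} := (convex_halfSpace_re_lt 1).isPreconnected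
  have ha0 : (a : ℂ) ≠ 0 := by exact_mod_cast ha.ne'
  have hHd : DifferentiableOn ℂ H {w : ℂ | w.re < 1} := by
    have h1 : Differentiable ℂ fun w : ℂ ↦ (a : ℂ) ^ (w - 1) := fun w ↦
      (differentiableAt_id.sub_const (1 : ℂ)).const_cpow (Or.inl ha0)
    have h2 : Differentiable ℂ fun w : ℂ ↦ (w - 1) / (π * u) :=
      (differentiable_id.sub_const _).div_const _
    exact ((differentiableOn_const _).mul h1.differentiableOn).sub
      (h2.differentiableOn.mul (differentiableOn_integral_sin_mul_cpow_Ioi ha u))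
  have hGa : AnalyticOnNhd ℂ G {w : ℂ | w.re < 1} := (hG.1.differentiableOn).analyticOnNhd hUo
  have hHa : AnalyticOnNhd ℂ H {w : ℂ | w.re < 1} := hHd.analyticOnNhd hUo
  have hz₀ : (-1 : ℂ) ∈ {w : ℂ | w.re < 1} := by simp
  have hev : G =ᶠ[𝓝 (-1 : ℂ)] H := by
    have hopen : IsOpen {w : ℂ | w.re < 0} := isOpen_lt Complex.continuous_re continuous_const
    have hmem : (-1 : ℂ) ∈ {w : ℂ | w.re < 0} := by simp
    filter_upwards [hopen.mem_nhds hmem] with z hz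
    rw [hG.2 z hz, hH]
    exact burnolC_eq_ibp ha hu hz
  have heq := hGa.eqOn_of_preconnected_of_eventuallyEq hHa hUc hz₀ hev hw
  rw [heq]

/-! ## Step 2: the strip `0 < Re w < 1` -/

/-- **The rescaled Mellin transform of the sine**: for `u > 0` and `0 < Re w < 1`,
`∫₀^∞ sin(2πut) t^{w−2} dt = (2πu)^{1−w} Γ(w−1) sin(π(w−1)/2)` (absolutely convergent; Euler's
integral `∫₀^∞ y^{−s−1} sin y dy = −Γ(−s) sin(πs/2)`, `−1 < σ < 0`, as used by Titchmarsh in the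
first proof of the functional equation — the tree's `Literature.Analysis.SpecialFunctions.mellin_sin`
at `z = w − 1 ∈ (−1, 0)` — after the substitution `y = 2πu t`).
[cite: Titchmarsh1986, §2.1, display after (2.1.7), p. 15] -/
theorem integral_sin_mul_cpow_Ioi_zero {u : ℝ} (hu : 0 < u) {w : ℂ} (hw0 : 0 < w.re)
    (hw1 : w.re < 1) :
    ∫ t in Ioi (0 : ℝ), ((Real.sin (2 * π * u * t) : ℝ) : ℂ) * (t : ℂ) ^ (w - 2) =
      ((2 * π * u : ℝ) : ℂ) ^ (-(w - 1)) *
        (Complex.Gamma (w - 1) * Complex.sin (π * (w - 1) / 2)) := by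
  have hc : 0 < 2 * π * u := by positivity
  have h1 : -1 < (w - 1).re := by rw [Complex.sub_re, Complex.one_re]; linarith
  have h2 : (w - 1).re < 0 := by rw [Complex.sub_re, Complex.one_re]; linarith
  have hm := mellin_comp_mul_left (fun t : ℝ ↦ ((Real.sin t : ℝ) : ℂ)) (w - 1) hc
  rw [Literature.Analysis.SpecialFunctions.mellin_sin h1 h2, smul_eq_mul] at hm
  rw [← hm, mellin]
  refine setIntegral_congr_fun measurableSet_Ioi (fun t _ ↦ ?_)
  rw [smul_eq_mul, mul_comm, show w - 1 - 1 = w - 2 by ring]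

/-- `sin(2πut) t^{w−2}` is integrable on `(0, ∞)` for `0 < Re w < 1`. [folklore] -/
private theorem integrableOn_sin_mul_cpow_Ioi_zero {u : ℝ} (hu : 0 < u) {w : ℂ} (hw0 : 0 < w.re)
    (hw1 : w.re < 1) :
    IntegrableOn (fun t : ℝ ↦ ((Real.sin (2 * π * u * t) : ℝ) : ℂ) * (t : ℂ) ^ (w - 2)) (Ioi 0) := by
  rw [← Ioc_union_Ioi_eq_Ioi zero_le_one]
  exact (integrableOn_sin_mul_cpow_Ioc one_pos hu hw0).union
    (integrableOn_sin_mul_cpow_Ioi one_pos u (by rw [Complex.sub_re]; norm_num; linarith))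

/-- **Integration by parts on `(0, a]`** for `Re w > 0` (`a, u > 0`):
`2∫₀^a cos(2πut) t^{w−1} dt = (sin(2πau)/(πu)) a^{w−1} − ((w−1)/(πu)) ∫₀^a sin(2πut) t^{w−2} dt`;
the boundary term at `0⁺` vanishes because `|t^{w−1} sin(2πut)| ≤ 2πu t^{Re w}`. [folklore] -/
private theorem two_mul_integral_cos_mul_cpow_Ioc {a u : ℝ} (ha : 0 < a) (hu : 0 < u) {w : ℂ}
    (hw : 0 < w.re) :
    2 * ∫ t in Ioc 0 a, ((Real.cos (2 * π * u * t) : ℝ) : ℂ) * (t : ℂ) ^ (w - 1) =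
      ((Real.sin (2 * π * u * a) : ℝ) : ℂ) / (π * u) * (a : ℂ) ^ (w - 1)
        - (w - 1) / (π * u) *
          ∫ t in Ioc 0 a, ((Real.sin (2 * π * u * t) : ℝ) : ℂ) * (t : ℂ) ^ (w - 2) := by
  have hπ : (π : ℂ) ≠ 0 := by exact_mod_cast Real.pi_ne_zero
  have hu' : (u : ℂ) ≠ 0 := by exact_mod_cast hu.ne'
  have hc : ((2 : ℂ) * π * u) ≠ 0 := mul_ne_zero (mul_ne_zero two_ne_zero hπ) hu'
  set f : ℝ → ℂ := fun t ↦ (t : ℂ) ^ (w - 1) *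
    (((Real.sin (2 * π * u * t) : ℝ) : ℂ) / (2 * π * u)) with hf
  set g₁ : ℝ → ℂ := fun t ↦ (w - 1) / (2 * π * u) *
    (((Real.sin (2 * π * u * t) : ℝ) : ℂ) * (t : ℂ) ^ (w - 2)) with hg₁
  set g₂ : ℝ → ℂ := fun t ↦ ((Real.cos (2 * π * u * t) : ℝ) : ℂ) * (t : ℂ) ^ (w - 1) with hg₂
  have hderiv : ∀ t ∈ Ioo 0 a, HasDerivAt f (g₁ t + g₂ t) t := by
    intro t ht
    have h := (hasDerivAt_ofReal_cpow ht.1 (w - 1)).mul (hasDerivAt_sin_div hu.ne' t)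
    refine h.congr_deriv ?_
    simp only [hg₁, hg₂]
    rw [show w - 1 - 1 = w - 2 by ring]
    field_simp
  have hg₁i : IntegrableOn g₁ (Ioc 0 a) := (integrableOn_sin_mul_cpow_Ioc ha hu hw).const_mul _
  have hg₂i : IntegrableOn g₂ (Ioc 0 a) :=
    integrableOn_cos_mul_cpow_Ioc ha u (by rw [Complex.sub_re, Complex.one_re]; linarith)
  have hint : IntervalIntegrable (fun t ↦ g₁ t + g₂ t) volume 0 a :=
    (intervalIntegrable_iff_integrableOn_Ioc_of_le ha.le).2 (hg₁i.add hg₂i)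
  have h0 : Tendsto f (𝓝[>] 0) (𝓝 0) := tendsto_boundary_zero hu hw
  have ha' : Tendsto f (𝓝[<] a) (𝓝 (f a)) :=
    ((continuousAt_boundary hu w ha).tendsto).mono_left nhdsWithin_le_nhds
  have hFTC := intervalIntegral.integral_eq_sub_of_hasDerivAt_of_tendsto ha hderiv hint h0 ha'
  rw [intervalIntegral.integral_of_le ha.le, integral_add hg₁i hg₂i, sub_zero] at hFTC
  have hI₁ : ∫ t in Ioc 0 a, g₁ t = (w - 1) / (2 * π * u) *
      ∫ t in Ioc 0 a, ((Real.sin (2 * π * u * t) : ℝ) : ℂ) * (t : ℂ) ^ (w - 2) := by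
    rw [hg₁, integral_const_mul]
  rw [hI₁] at hFTC
  have hI₂ : ∫ t in Ioc 0 a, g₂ t = f a - (w - 1) / (2 * π * u) *
      ∫ t in Ioc 0 a, ((Real.sin (2 * π * u * t) : ℝ) : ℂ) * (t : ℂ) ^ (w - 2) := by
    rw [← hFTC]; ring
  rw [hI₂]
  simp only [hf]
  field_simp

/-- `γ₊(w) u^{−w} = −((w−1)/(πu)) · (2πu)^{−(w−1)} Γ(w−1) sin(π(w−1)/2)` for `u > 0` and `w ≠ 1`
(`Γ(w) = (w−1)Γ(w−1)`, `sin(x − π/2) = −cos x`, `(2π)^{−w} u^{−w} = (2πu)^{−w}`). [folklore] -/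
private theorem gammaPlus_mul_cpow_eq {u : ℝ} (hu : 0 < u) {w : ℂ} (hw : w ≠ 1) :
    gammaPlus w * (u : ℂ) ^ (-w) =
      -((w - 1) / (π * u)) * (((2 * π * u : ℝ) : ℂ) ^ (-(w - 1)) *
        (Complex.Gamma (w - 1) * Complex.sin (π * (w - 1) / 2))) := by
  have hπ : (π : ℂ) ≠ 0 := by exact_mod_cast Real.pi_ne_zero
  have hu' : (u : ℂ) ≠ 0 := by exact_mod_cast hu.ne'
  have hc : (((2 * π * u : ℝ) : ℂ)) ≠ 0 := by
    push_cast; exact mul_ne_zero (mul_ne_zero two_ne_zero hπ) hu'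
  have hw1 : w - 1 ≠ 0 := sub_ne_zero.2 hw
  -- Γ(w) = (w − 1) Γ(w − 1)
  have hΓ : Complex.Gamma w = (w - 1) * Complex.Gamma (w - 1) := by
    have := Complex.Gamma_add_one (w - 1) hw1
    rwa [sub_add_cancel] at this
  -- sin(π(w−1)/2) = −cos(πw/2)
  have hsin : Complex.sin (π * (w - 1) / 2) = -Complex.cos (π * w / 2) := by
    rw [show (π : ℂ) * (w - 1) / 2 = π * w / 2 - π / 2 by ring, Complex.sin_sub_pi_div_two]
  -- (2πu)^{−(w−1)} = (2πu)^{−w} · (2πu)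
  have hpow : ((2 * π * u : ℝ) : ℂ) ^ (-(w - 1)) =
      ((2 * π * u : ℝ) : ℂ) ^ (-w) * ((2 * π * u : ℝ) : ℂ) := by
    rw [show -(w - 1) = -w + 1 by ring, Complex.cpow_add _ _ hc, Complex.cpow_one]
  -- (2πu)^{−w} = (2π)^{−w} u^{−w}
  have hsplit : ((2 * π * u : ℝ) : ℂ) ^ (-w) = (2 * π : ℂ) ^ (-w) * (u : ℂ) ^ (-w) := by
    rw [show ((2 * π * u : ℝ) : ℂ) = ((2 * π : ℝ) : ℂ) * (u : ℂ) by push_cast; ring,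
      Complex.mul_cpow_ofReal_nonneg (by positivity) hu.le]
    push_cast
    rfl
  rw [hpow, hsplit, hsin, gammaPlus, hΓ]
  push_cast
  field_simp

/-- **Eq. (1.3) on the strip** `0 < Re w < 1`: the integrated-by-parts expression equals
`γ₊(w) u^{−w} − 2∫₀^a cos(2πut) t^{w−1} dt`. [cite: Burnol2001CRAS, eq. (1.3) (TeX l.352–355)] -/
theorem ibp_eq_closedForm {a u : ℝ} (ha : 0 < a) (hu : 0 < u) {w : ℂ} (hw0 : 0 < w.re)
    (hw1 : w.re < 1) :
    -(((Real.sin (2 * π * u * a) : ℝ) : ℂ) / (π * u)) * (a : ℂ) ^ (w - 1)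
        - (w - 1) / (π * u) *
          ∫ t in Ioi a, ((Real.sin (2 * π * u * t) : ℝ) : ℂ) * (t : ℂ) ^ (w - 2) =
      gammaPlus w * (u : ℂ) ^ (-w) -
        2 * ∫ t in Ioc 0 a, ((Real.cos (2 * π * u * t) : ℝ) : ℂ) * (t : ℂ) ^ (w - 1) := by
  have hw : w ≠ 1 := fun h ↦ by rw [h, Complex.one_re] at hw1; exact lt_irrefl _ hw1
  -- split `∫_a^∞ = ∫_0^∞ − ∫_0^a`
  have hsplit : ∫ t in Ioi a, ((Real.sin (2 * π * u * t) : ℝ) : ℂ) * (t : ℂ) ^ (w - 2) =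
      (∫ t in Ioi (0 : ℝ), ((Real.sin (2 * π * u * t) : ℝ) : ℂ) * (t : ℂ) ^ (w - 2)) -
        ∫ t in Ioc 0 a, ((Real.sin (2 * π * u * t) : ℝ) : ℂ) * (t : ℂ) ^ (w - 2) := by
    rw [eq_sub_iff_add_eq', ← setIntegral_union (Ioc_disjoint_Ioi le_rfl) measurableSet_Ioi
      (integrableOn_sin_mul_cpow_Ioc ha hu hw0)
      (integrableOn_sin_mul_cpow_Ioi ha u (by rw [Complex.sub_re]; norm_num; linarith)),
      Ioc_union_Ioi_eq_Ioi ha.le]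
  rw [hsplit, integral_sin_mul_cpow_Ioi_zero hu hw0 hw1, gammaPlus_mul_cpow_eq hu hw,
    two_mul_integral_cos_mul_cpow_Ioc ha hu hw0]
  ring

/-! ## Step 3: the closed form on `Re w > 0` and the discharge -/

/-- The right-hand side of (1.3) is holomorphic on `Re w > 0`. [folklore] -/
private theorem differentiableOn_closedForm {a u : ℝ} (ha : 0 < a) (hu : 0 < u) :
    DifferentiableOn ℂ (fun w : ℂ ↦ gammaPlus w * (u : ℂ) ^ (-w) -
        2 * ∫ t in Ioc 0 a, ((Real.cos (2 * π * u * t) : ℝ) : ℂ) * (t : ℂ) ^ (w - 1))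
      {w : ℂ | 0 < w.re} := by
  have hπ : (π : ℂ) ≠ 0 := by exact_mod_cast Real.pi_ne_zero
  have hu' : (u : ℂ) ≠ 0 := by exact_mod_cast hu.ne'
  have h2π : (2 * π : ℂ) ≠ 0 := mul_ne_zero two_ne_zero hπ
  -- γ₊ is holomorphic on Re w > 0
  have hγ : DifferentiableOn ℂ (fun w : ℂ ↦ gammaPlus w * (u : ℂ) ^ (-w)) {w : ℂ | 0 < w.re} := by
    intro w hw
    have hw' : 0 < w.re := hw
    have hΓ : DifferentiableAt ℂ Complex.Gamma w := by
      refine Complex.differentiableAt_Gamma w (fun m h ↦ ?_)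
      rw [h] at hw'
      simp at hw'
      linarith [Nat.cast_nonneg (α := ℝ) m]
    have h1 : DifferentiableAt ℂ (fun w : ℂ ↦ (2 * π : ℂ) ^ (-w)) w :=
      differentiableAt_id.neg.const_cpow (Or.inl h2π)
    have h2 : DifferentiableAt ℂ (fun w : ℂ ↦ Complex.cos (π * w / 2)) w :=
      ((differentiableAt_id.const_mul _).div_const _).ccos
    have h3 : DifferentiableAt ℂ (fun w : ℂ ↦ (u : ℂ) ^ (-w)) w :=
      differentiableAt_id.neg.const_cpow (Or.inl hu')
    have h4 : DifferentiableAt ℂ (fun w : ℂ ↦ gammaPlus w) w := by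
      unfold gammaPlus
      exact (((differentiableAt_const _).mul h1).mul h2).mul hΓ
    exact (h4.mul h3).differentiableWithinAt
  -- the integral over (0, a] is holomorphic on Re w > 0
  have hI : DifferentiableOn ℂ
      (fun w : ℂ ↦ ∫ t in Ioc 0 a, ((Real.cos (2 * π * u * t) : ℝ) : ℂ) * (t : ℂ) ^ (w - 1))
      {w : ℂ | 0 < w.re} := by
    refine Literature.Analysis.Complex.differentiableOn_integral_of_dominated
      (μ := volume.restrict (Ioc 0 a))
      (F := fun (w : ℂ) (t : ℝ) ↦ ((Real.cos (2 * π * u * t) : ℝ) : ℂ) * (t : ℂ) ^ (w - 1))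
      (fun w _ ↦ ?_) ?_ (fun x₀ hx₀ ↦ ?_)
    · exact ((continuous_cosC u).continuousOn.mul
        ((continuousOn_ofReal_cpow (w - 1)).mono Ioc_subset_Ioi_self)).aestronglyMeasurable
        measurableSet_Ioc
    · filter_upwards [ae_restrict_mem measurableSet_Ioc] with t ht
      have ht0 : (t : ℂ) ≠ 0 := by exact_mod_cast ht.1.ne'
      exact (Differentiable.differentiableOn fun w ↦
        (((differentiableAt_id.sub_const (1 : ℂ)).const_cpow (Or.inl ht0)).const_mul _))
    · have hx₀' : 0 < x₀.re := hx₀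
      set R : ℝ := x₀.re / 2 with hR
      have hR0 : 0 < R := by rw [hR]; linarith
      have hint : ∀ σ : ℝ, 0 < σ → IntegrableOn (fun t : ℝ ↦ t ^ (σ - 1)) (Ioc 0 a) := fun σ hσ ↦
        (intervalIntegrable_iff_integrableOn_Ioc_of_le ha.le).1
          (intervalIntegral.intervalIntegrable_rpow' (a := 0) (b := a) (by linarith))
      refine ⟨R, hR0, fun p hp ↦ ?_, fun t ↦ t ^ (x₀.re + R - 1) + t ^ (x₀.re - R - 1), ?_, ?_⟩
      · show 0 < p.re
        have h1 : |(p - x₀).re| ≤ ‖p - x₀‖ := Complex.abs_re_le_norm _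
        rw [mem_ball, dist_eq_norm] at hp
        rw [Complex.sub_re] at h1
        have := (abs_le.1 h1).1
        linarith
      · exact (hint (x₀.re + R) (by linarith)).add (hint (x₀.re - R) (by linarith))
      · filter_upwards [ae_restrict_mem measurableSet_Ioc] with t ht p hp
        have ht0 : 0 < t := ht.1
        have hp' : |p.re - x₀.re| < R := by
          have h1 : |(p - x₀).re| ≤ ‖p - x₀‖ := Complex.abs_re_le_norm _
          rw [mem_ball, dist_eq_norm] at hp
          rw [Complex.sub_re] at h1
          exact lt_of_le_of_lt h1 hp
        rw [norm_mul, norm_ofReal_cpow ht0, Complex.sub_re, Complex.one_re]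
        have hle : t ^ (p.re - 1) ≤ t ^ (x₀.re + R - 1) + t ^ (x₀.re - R - 1) := by
          rcases le_or_gt 1 t with h1 | h1
          · calc t ^ (p.re - 1) ≤ t ^ (x₀.re + R - 1) :=
                Real.rpow_le_rpow_of_exponent_le h1 (by linarith [(abs_lt.1 hp').2])
              _ ≤ t ^ (x₀.re + R - 1) + t ^ (x₀.re - R - 1) :=
                le_add_of_nonneg_right (Real.rpow_nonneg ht0.le _)
          · calc t ^ (p.re - 1) ≤ t ^ (x₀.re - R - 1) :=
                Real.rpow_le_rpow_of_exponent_ge ht0 h1.le (by linarith [(abs_lt.1 hp').1])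
              _ ≤ t ^ (x₀.re + R - 1) + t ^ (x₀.re - R - 1) :=
                le_add_of_nonneg_left (Real.rpow_nonneg ht0.le _)
        calc ‖((Real.cos (2 * π * u * t) : ℝ) : ℂ)‖ * t ^ (p.re - 1)
            ≤ 1 * t ^ (p.re - 1) :=
              mul_le_mul_of_nonneg_right (norm_ofReal_cos_le _) (Real.rpow_nonneg ht0.le _)
          _ ≤ t ^ (x₀.re + R - 1) + t ^ (x₀.re - R - 1) := by rw [one_mul]; exact hle
  exact hγ.sub ((differentiableOn_const _).mul hI)

/-- **Burnol 2001, eq. (1.3) / Lemme 1.3, closed form on `Re w > 0`**: for `a, u > 0` and the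
entire continuation `G` of `C_a(u, ·)`,
`G(w) = γ₊(w) u^{−w} − 2∫₀^a cos(2πut) t^{w−1} dt` whenever `Re w > 0`.
[cite: Burnol2001CRAS, Lemme 1.3 and eq. (1.3) (TeX l.352–362)] -/
theorem IsBurnolC.eq_closedForm {a u : ℝ} (ha : 0 < a) (hu : 0 < u) {G : ℂ → ℂ}
    (hG : IsBurnolC a u G) {w : ℂ} (hw : 0 < w.re) :
    G w = gammaPlus w * (u : ℂ) ^ (-w) -
      2 * ∫ t in Ioc 0 a, ((Real.cos (2 * π * u * t) : ℝ) : ℂ) * (t : ℂ) ^ (w - 1) := by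
  set R : ℂ → ℂ := fun w ↦ gammaPlus w * (u : ℂ) ^ (-w) -
      2 * ∫ t in Ioc 0 a, ((Real.cos (2 * π * u * t) : ℝ) : ℂ) * (t : ℂ) ^ (w - 1) with hR
  have hUo : IsOpen {w : ℂ | 0 < w.re} := isOpen_lt continuous_const Complex.continuous_re
  have hUc : IsPreconnected {w : ℂ | 0 < w.re} := (convex_halfSpace_re_gt 0).isPreconnected
  have hGa : AnalyticOnNhd ℂ G {w : ℂ | 0 < w.re} := (hG.1.differentiableOn).analyticOnNhd hUo
  have hRa : AnalyticOnNhd ℂ R {w : ℂ | 0 < w.re} :=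
    (differentiableOn_closedForm ha hu).analyticOnNhd hUo
  have hz₀ : ((1 / 2 : ℝ) : ℂ) ∈ {w : ℂ | 0 < w.re} := by
    show 0 < ((1 / 2 : ℝ) : ℂ).re
    rw [Complex.ofReal_re]; norm_num
  have hev : G =ᶠ[𝓝 ((1 / 2 : ℝ) : ℂ)] R := by
    have hopen : IsOpen ({w : ℂ | 0 < w.re} ∩ {w : ℂ | w.re < 1}) :=
      hUo.inter (isOpen_lt Complex.continuous_re continuous_const)
    have hmem : ((1 / 2 : ℝ) : ℂ) ∈ {w : ℂ | 0 < w.re} ∩ {w : ℂ | w.re < 1} := by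
      constructor
      · show 0 < ((1 / 2 : ℝ) : ℂ).re
        rw [Complex.ofReal_re]; norm_num
      · show ((1 / 2 : ℝ) : ℂ).re < 1
        rw [Complex.ofReal_re]; norm_num
    filter_upwards [hopen.mem_nhds hmem] with z hz
    have hz0 : 0 < z.re := hz.1
    have hz1 : z.re < 1 := hz.2
    rw [hG.eq_ibp ha hu hz1, hR]
    exact ibp_eq_closedForm ha hu hz0 hz1
  have heq := hGa.eqOn_of_preconnected_of_eventuallyEq hRa hUc hz₀ hev hw
  rw [heq]

/-- `γ₊(1 + 2j) = 0` (`j ∈ ℕ`): the zero of `cos(πs/2)` at `s = 1 + 2j` ("les seuls zéros de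
`γ₊(w)` étant en `1, 3, 5, …`", TeX l.361). [cite: Burnol2001CRAS, §1 (TeX l.361)] -/
theorem gammaPlus_one_add_two_mul_natCast (j : ℕ) : gammaPlus (1 + 2 * (j : ℂ)) = 0 := by
  have hcos : Complex.cos (π * (1 + 2 * (j : ℂ)) / 2) = 0 :=
    Complex.cos_eq_zero_iff.2 ⟨j, by push_cast; ring⟩
  simp [gammaPlus, hcos]

/-- **Burnol 2001, Lemme 1.3, the values at `1 + 2j`**: `C_a(u, 1+2j) = −2∫₀^a cos(2πut) t^{2j} dt`
(`= −𝓕₊(𝟙_{t≤a} t^{2j})(u)`), for the entire continuation `G` of `C_a(u, ·)`.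
[cite: Burnol2001CRAS, Lemme 1.3 (TeX l.366–367)] -/
theorem IsBurnolC.eq_at_one_add_two_mul {a u : ℝ} (ha : 0 < a) (hu : 0 < u) {G : ℂ → ℂ}
    (hG : IsBurnolC a u G) (j : ℕ) :
    G (1 + 2 * j) = -(2 * ∫ t in Ioc 0 a, ((Real.cos (2 * π * u * t) : ℝ) : ℂ) * (t : ℂ) ^ (2 * j)) := by
  have hre : 0 < (1 + 2 * (j : ℂ)).re := by
    simp
    positivity
  rw [hG.eq_closedForm ha hu hre, gammaPlus_one_add_two_mul_natCast, zero_mul, zero_sub]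
  congr 2
  refine setIntegral_congr_fun measurableSet_Ioc (fun t _ ↦ ?_)
  rw [show (1 + 2 * (j : ℂ)) - 1 = ((2 * j : ℕ) : ℂ) by push_cast; ring, Complex.cpow_natCast]

/-- **Discharge of `Burnol2001CRAS_lem1_3`** (Burnol 2001, Lemme 1.3, closed-form clauses): for
`a, u > 0` and the entire continuation `G` of `C_a(u, ·)`, (i) `G(w) = γ₊(w) u^{−w} − 2∫₀^a cos(2πut)
t^{w−1} dt` on `Re w > 0`, (ii) `G(1 + 2j) = −2∫₀^a cos(2πut) t^{2j} dt`.
[cite: Burnol2001CRAS, Lemme 1.3 (TeX l.358–367)] -/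
theorem Burnol2001CRAS_lem1_3_holds : Burnol2001CRAS_lem1_3 := by
  intro a u ha hu G hG
  exact ⟨fun w hw ↦ hG.eq_closedForm ha hu hw, fun j ↦ hG.eq_at_one_add_two_mul ha hu j⟩

end Burnol2001

end Literature.Analysis.DeBrangesSpaces
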